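import Summits.AtomisticToContinuum.Crystallization.Theorems.FluxTubeKeplerFloorGivesLayered
import Summits.AtomisticToContinuum.Crystallization.Theorems.FluxTubeKeplerFluxCellKeplerSingleScale

/-!
# F3 witness for the forward rung `OnePointRung` (cell ladder over `FluxTubeKepler.FloorGivesLayered`)

`CellRung univ` — FLOOR + the defect budget at EVERY cell `(R, η)` of the radius × tolerance dial force periodic
windows — is the proved floor: the seed `FluxTubeKeplerFloorGivesLayered.FloorGivesLayered_proof`
(stmt-AtomisticToContinuum-15223) followed by the proved `FluxTubeKepler.PeriodicGivenLayered_holds`; the only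
rewriting is the vacuous membership `(R, η) ∈ univ`.  Self-contained copy (sub-namespace `Special`) of the
definitions of `Lines/OnePointRung.lean`, so that this file elaborates on its own; the canonical declarations
`CellLadder.CellRung`, `CellLadder.cellRung_univ` live there with the same text.  No `sorry`.
-/

noncomputable section

namespace Summit.AtomisticToContinuum.Crystallization.Cruxes.FluxCellKepler.CellLadder.Special

open Filter Topology
open Literature.MathematicalPhysics.StatisticalMechanics
open Summit.AtomisticToContinuum.Crystallization.Theorems.FluxCellKeplerSingleScale (LayeredGood)

local notation "E3" => EuclideanSpace ℝ (Fin 3)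

/-- FLOOR(P₀) (verbatim copy of `CellLadder.Floor` in `Lines/OnePointRung.lean`). -/
def Floor (P₀ : PeriodicConfiguration 3) : Prop :=
  ∀ (N : ℕ) (x : Fin N → E3), IsGroundState lennardJones x →
    (N : ℝ) * P₀.energyPerParticle lennardJones ≤ interactionEnergy lennardJones x

/-- BUDGET(P₀) on the cells `𝓢` (verbatim copy of `CellLadder.Budget`). -/
def Budget (𝓢 : Set (ℝ × ℝ)) (P₀ : PeriodicConfiguration 3) : Prop :=
  ∀ R η : ℝ, (R, η) ∈ 𝓢 → 0 < R → 0 < η → ∃ c : ℝ, 0 < c ∧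
    ∀ (N : ℕ) (x : Fin N → E3), IsGroundState lennardJones x →
      c * (Nat.card {i : Fin N // ¬ LayeredGood R η x i} : ℝ) ≤
        interactionEnergy lennardJones x - (N : ℝ) * P₀.energyPerParticle lennardJones

/-- Periodic windows along `x` (verbatim copy of `CellLadder.HasPeriodicWindows`). -/
def HasPeriodicWindows (x : (N : ℕ) → (Fin N → E3)) : Prop :=
  ∃ P : PeriodicConfiguration 3, ∀ R ε : ℝ, 0 < ε → ∃ᶠ N in atTop, ∃ t : E3,
    (∀ s ∈ P.points, ‖s‖ ≤ R → ∃ i : Fin N, dist (x N i + t) s ≤ ε) ∧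
    (∀ i : Fin N, ‖x N i + t‖ ≤ R → ∃ s ∈ P.points, dist (x N i + t) s ≤ ε)

/-- The graded family (verbatim copy of `CellLadder.CellRung`). -/
def CellRung (𝓢 : Set (ℝ × ℝ)) : Prop :=
  ∀ P₀ : PeriodicConfiguration 3, Floor P₀ → Budget 𝓢 P₀ →
    ∀ x : (N : ℕ) → (Fin N → E3), (∀ N, IsGroundState lennardJones (x N)) → HasPeriodicWindows x

/-- The one cell (verbatim copy of `CellLadder.cell`). -/
def cell (η₀ : ℝ) : Set (ℝ × ℝ) := {((6 : ℝ) / 5, η₀)}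

/-- Deciding rung (verbatim copy of `CellLadder.OnePointRung`). -/
def OnePointRung : Prop := ∃ η₀ : ℝ, 0 < η₀ ∧ CellRung (cell η₀)

/-- **F3.** `CellRung univ` is the floor: seed + proved `PeriodicGivenLayered`. -/
theorem cellRung_univ : CellRung Set.univ := fun P₀ hF hB x hx =>
  Theses.FluxTubeKepler.PeriodicGivenLayered_holds x hx
    (Theorems.FluxTubeKeplerFloorGivesLayered.FloorGivesLayered_proof P₀ hF
      (fun R η hR hη => hB R η (Set.mem_univ _) hR hη) x hx)

/-- The instantiated rung, by `simpa` (the brief's literal shape). -/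
example : CellRung Set.univ := by simpa [CellRung] using cellRung_univ

/-- `CellRung` is monotone in the set of cells (fewer cells asked = harder rung). -/
theorem cellRung_mono {𝓢 𝓣 : Set (ℝ × ℝ)} (h : 𝓢 ⊆ 𝓣) : CellRung 𝓢 → CellRung 𝓣 :=
  fun H P₀ hF hB x hx => H P₀ hF (fun R η hmem hR hη => hB R η (h hmem) hR hη) x hx

/-- The deciding rung gives back the floor member (informational `specialises`). -/
theorem cellRung_univ_of_onePointRung (h : OnePointRung) : CellRung Set.univ := by
  obtain ⟨η₀, _, h⟩ := h
  exact cellRung_mono (Set.subset_univ _) h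

end Summit.AtomisticToContinuum.Crystallization.Cruxes.FluxCellKepler.CellLadder.Special

end
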